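import Mathlib
import HarnessLib
import Summits.HubbardSuperconductivity.HubbardSuperconductivity.Theorems.WeakCouplingBCSKlResummedSlot
import Summits.HubbardSuperconductivity.HubbardSuperconductivity.Theorems.WeakCouplingBCSKlThirdOrderM3Record
import Summits.HubbardSuperconductivity.HubbardSuperconductivity.Theorems.WeakCouplingBCSKlCertB1gDopingWindowD010D020

/-!
# WeakCouplingBCS — KL certificate: the two-sided CHAIN-RESUMMED literals `M_res` per window record and the explicit
# `U₀(δ) = γ(δ)/2M_res` rows on `0 < U ≤ U₁ = 1/16` (CLAIMED-conditional; twin of `…KlThirdOrderM3Record`, motion «M3-LITERAL-RECORD» extended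
# to the resummed kernel under the same guards (1)–(4) of pen (R499)(B))

For each `t′ = 0` window record of `δ ∈ [0.10, 0.20]` ONE rational literal `M_res` is typed (§1) and enters every theorem ONLY as the named
hypothesis `(hM : KlThirdOrder.ResummedFormBound 0 mub mua M_res (1/16))` of `…KlResummedSlot` (never discharged in the tree).  The slot
threshold `klU0 γ M_res (1/16)` EVALUATES to the exact rational `γ/2M_res` (§2, `decide +kernel` rows with a dyadic floor; `klU0_eq_div` of the twin record), and §3 specialises
`klChannelInfRes_B1g_lt_Win{A,B,C}` / `…_window_d010_d020`: **for every `μ` of the record window, every `0 < U < γ/2M_res` and every `χ ≠ B1g`,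
`channelInfRes ε₀ μ U B1g < channelInfRes ε₀ μ U χ`** — `B1g` selection through third order WITH the bubble/ladder chains resummed to all orders;
§4 restates the two window rows (third order, ✓ `…KlThirdOrderM3Record`; resummed, §3) AS FUNCTIONS OF THE HOLE DOPING `δ ∈ [0.10, 0.20]` at the free-band
chemical potential `μ(δ) = chemicalPotentialOfDensity ε₀ (1 − δ)` (✓ `muOfDoping_mem_window_d010_d020`, kernel-checked filling certificates).

LABEL OF RECORD: «`U₀(δ) = γ(δ)/2M_res` — CONDITIONAL on `hE` (kernel-checked enclosures, RECORD class) AND `hM` (CLAIMED-class kit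
Hilbert–Schmidt bounds)».  No RECORD/DECIDED word attaches to `M_res`.

| record | window `μ` | `γ` (tree) | `M_res` literal | `U₀ = γ/2M_res` (exact) | ≈ | binding slab |
|---|---|---|---|---|---|---|
| `klCertB1gWinA` | `[−0.42749, −0.3775]` | `30209/2²⁰` | `30883/1024` | `30209/63248384` | `4.78·10⁻⁴` | `w1s09` |
| `klCertB1gWinB` | `[−0.3775, −0.2275]` | `437/16384` | `66388/1024` | `437/2124416` | `2.06·10⁻⁴` | `w2s11` |
| `klCertB1gWinC` | `[−0.2275, −0.1775]` | `32921/2²⁰` | `99574/1024` | `32921/203927552` | `1.61·10⁻⁴` | `w2s21` |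
| window `δ ∈ [0.10, 0.20]` | `[−0.42749, −0.1775]` | `437/16384` (min) | `99574/1024` (max) | `437/3186368` | `1.37·10⁻⁴` | `w2s21` |

PROVENANCE (zero kit — a RE-READ of existing certified outputs, nothing re-run or re-tuned): the SAME 88 files as `…KlThirdOrderM3Record`
(the 44 V4 slab assemblies `assemble6-<slab>nc8192-impl{1,2}.json` listed in `HOME/margin-1-g11/rows/cfg_V4.json`, sha16 `2f34bbe907c7adc2`,
under `HOME/margin-1-g9/data/slabs-d1234/`, `HOME/margin-1-g11/data/slabs-d34/`, `HOME/margin-1-g9/data/slabs-c1234/`; HOME =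
`run/shared/lean/pub/gate-hubbard-kl`; engine margin-1 g6 `assemble6.py`, chain layer with `JOB_U1 = 1/16` — field `U1 = 0.0625` asserted in
every file), plus the two chain-envelope fields `h4e_tree = ‖g₄ᵉ(U₁, x̄)‖_HS`, `h4o_tree = ‖g₄ᵒ(U₁, x̄)‖_HS` (`g₄ᵉ(U,x) = x³/(1−Ux) + Ux⁴/(1−U²x²)`,
`g₄ᵒ = x³/(1−U²x²)`, monotone in `U` and in `x ≥ 0`; `x̄ ≥ χ₀ ≥ 0` boxwise).  Per slab (larger implementation per quantity):
`M_even = h3 + U₁·h4e + t_B` (even `ψ`: the resummed chain kernel's form is that of `2x² + U·g₄ᵉ(U,x)`, `x = χ₀(k+k') ≥ 0`; two-loop `|·| ≤ t_B` as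
in the twin), `M_odd = U₁·h4o + min(2t_B, t_B + t_E, ΣHS parts, √((‖TsV‖+‖NP‖)² + (‖NV‖+‖SsP‖)²))` (odd `ψ`: resummed chain form = that of
`U·g₄ᵒ(U,x)`), `M_slab = max(M_even, M_odd)` — a bound of `|⟨ψ, K_res(U) ψ⟩_{σ_μ}|` for every normalised parity-definite `ψ ∈ L²(σ_μ)`, `μ` in the
slab, `0 < U ≤ 1/16`; per record `M_res = (⌈1024 · max_slabs M_slab⌉ + 1)/1024`.  The chain envelopes add `≤ 0.14` to the third-order literals
(`h4e ≤ 2.18`, `h4o ≤ 2.02` on the window).  Binding files (sha16 impl1/impl2): w1s09 `88528f30f724ef8e`/`8b96da671c031601`, w2s11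
`9d0ccc9927827da5`/`36ab5bd70654c3ee`, w2s21 `b061897c791d8a95`/`bcbdae99c5fc397c`; script, table and summary:
`HOME/margin-1-g19/m3/{mres_read.py, mres_table.md, mres_summary.json}`, memo `HOME/margin-1-g19/M3-LITERAL-RECORD.md` §7.
«One-sided v4 sibling (`klResummed_selection_window`, `U₀ = klU0WindowU = 1145/2²⁴ ≈ 6.8·10⁻⁵` v3 / `1693/2²³ ≈ 2.0·10⁻⁴` V4 uniform) is the
sharper Ritz-currency statement; this is the two-sided re-read in the slot's currency.»

Honest framing: literals CLAIMED-class (kit interval arithmetic in two implementations, re-read); `hE` RECORD-class; the statement is about the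
pp-irreducible vertex through third order PLUS the two chain families to all orders — the NON-CHAIN diagrams of order `≥ 4` are NOT included
(they remain the abstract remainder `R`/`C` of `klLambdaR`); register expectation 0.00; RECORD ≠ DECIDED; not ODLRO; nothing here proves
superconductivity in the Hubbard model.  Filed `--supports stmt-HubbardSuperconductivity-0158`.

References: D. J. Scalapino, E. Loh, J. E. Hirsch, Phys. Rev. B 34 (1986) 8190, (3)–(4); S. Raghu, S. A. Kivelson, D. J. Scalapino,
Phys. Rev. B 81 (2010) 224505, §IV–V, App. A.
-/

noncomputable section

-- the tree's namespace `Summit.<Summit>.<Problem>.Theorems` repeats the summit name by design (D-0017)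
set_option linter.dupNamespace false

namespace Summit.HubbardSuperconductivity.HubbardSuperconductivity.Theorems

open Literature.MathematicalPhysics.QuantumLattice CwKLChiralWindow KlThirdOrder

/-! ### §1 The literals (CLAIMED-class; they enter only through `KlThirdOrder.ResummedFormBound 0 mub mua M_res (1/16)`) -/

/-- `M_res` for `klCertB1gWinA`: `30883/1024 ≈ 30.159` (binding slab w1s09). [folklore] -/
def klMresWinA : ℚ := 30883 / 1024

/-- `M_res` for `klCertB1gWinB`: `66388/1024 ≈ 64.832` (binding slab w2s11). [folklore] -/
def klMresWinB : ℚ := 66388 / 1024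

/-- `M_res` for `klCertB1gWinC`: `99574/1024 ≈ 97.240` (binding slab w2s21). [folklore] -/
def klMresWinC : ℚ := 99574 / 1024

/-- `M_res` for the whole doping window `μ ∈ [−0.42749, −0.1775]`: the largest of the three, `99574/1024`. [folklore] -/
def klMresWindowD010D020 : ℚ := 99574 / 1024

/-- The window literal is the maximum of the three record literals (kernel decision). [folklore] -/
theorem klMresWindowD010D020_eq_max : max (max klMresWinA klMresWinB) klMresWinC = klMresWindowD010D020 := by decide +kernel

/-! ### §2 The slot threshold evaluates: `klU0 γ M_res (1/16) = γ/2M_res` (exact rationals, kernel rows) -/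

/-- ROW `WinA` (kernel): `γ_A/2M_res = 30209/63248384`, `2⁻¹² < · < 1/16`. [folklore] -/
theorem klU0rowRes_WinA : klCertB1gWinA.gamma / (2 * klMresWinA) = 30209 / 63248384 ∧
    (1 : ℚ) / 2 ^ 12 < 30209 / 63248384 ∧ (30209 : ℚ) / 63248384 < 1 / 16 := by decide +kernel

/-- ROW `WinB` (kernel): `γ_B/2M_res = 437/2124416`, `2⁻¹³ < · < 1/16`. [folklore] -/
theorem klU0rowRes_WinB : klCertB1gWinB.gamma / (2 * klMresWinB) = 437 / 2124416 ∧
    (1 : ℚ) / 2 ^ 13 < 437 / 2124416 ∧ (437 : ℚ) / 2124416 < 1 / 16 := by decide +kernel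

/-- ROW `WinC` (kernel): `γ_C/2M_res = 32921/203927552`, `2⁻¹³ < · < 1/16`. [folklore] -/
theorem klU0rowRes_WinC : klCertB1gWinC.gamma / (2 * klMresWinC) = 32921 / 203927552 ∧
    (1 : ℚ) / 2 ^ 13 < 32921 / 203927552 ∧ (32921 : ℚ) / 203927552 < 1 / 16 := by decide +kernel

/-- ROW window (kernel): `(437/16384)/2M_res = 437/3186368`, `2⁻¹³ < · < 1/16`. [folklore] -/
theorem klU0rowRes_window_d010_d020 : (437 / 16384 : ℚ) / (2 * klMresWindowD010D020) = 437 / 3186368 ∧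
    (1 : ℚ) / 2 ^ 13 < 437 / 3186368 ∧ (437 : ℚ) / 3186368 < 1 / 16 := by decide +kernel

/-- `klU0 γ_A M_res(A) (1/16) = 30209/63248384 ≈ 4.78·10⁻⁴`. [folklore] -/
theorem klU0_WinA_Mres : klU0 ((klCertB1gWinA.gamma : ℚ) : ℝ) ((klMresWinA : ℚ) : ℝ) (1 / 16) = 30209 / 63248384 := by
  obtain ⟨h, -, h1⟩ := klU0rowRes_WinA
  have hC : (0 : ℝ) < ((klMresWinA : ℚ) : ℝ) := by
    have : (0 : ℚ) < klMresWinA := by decide +kernel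
    exact_mod_cast this
  have h' : ((klCertB1gWinA.gamma : ℚ) : ℝ) / (2 * ((klMresWinA : ℚ) : ℝ)) = 30209 / 63248384 := by
    have := congrArg (fun q : ℚ => (q : ℝ)) h
    push_cast at this
    exact this
  rw [klU0_eq_div hC (by rw [h']; norm_num) (by rw [h']; norm_num), h']

/-- `klU0 γ_B M_res(B) (1/16) = 437/2124416 ≈ 2.06·10⁻⁴`. [folklore] -/
theorem klU0_WinB_Mres : klU0 ((klCertB1gWinB.gamma : ℚ) : ℝ) ((klMresWinB : ℚ) : ℝ) (1 / 16) = 437 / 2124416 := by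
  obtain ⟨h, -, h1⟩ := klU0rowRes_WinB
  have hC : (0 : ℝ) < ((klMresWinB : ℚ) : ℝ) := by
    have : (0 : ℚ) < klMresWinB := by decide +kernel
    exact_mod_cast this
  have h' : ((klCertB1gWinB.gamma : ℚ) : ℝ) / (2 * ((klMresWinB : ℚ) : ℝ)) = 437 / 2124416 := by
    have := congrArg (fun q : ℚ => (q : ℝ)) h
    push_cast at this
    exact this
  rw [klU0_eq_div hC (by rw [h']; norm_num) (by rw [h']; norm_num), h']

/-- `klU0 γ_C M_res(C) (1/16) = 32921/203927552 ≈ 1.61·10⁻⁴`. [folklore] -/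
theorem klU0_WinC_Mres : klU0 ((klCertB1gWinC.gamma : ℚ) : ℝ) ((klMresWinC : ℚ) : ℝ) (1 / 16) = 32921 / 203927552 := by
  obtain ⟨h, -, h1⟩ := klU0rowRes_WinC
  have hC : (0 : ℝ) < ((klMresWinC : ℚ) : ℝ) := by
    have : (0 : ℚ) < klMresWinC := by decide +kernel
    exact_mod_cast this
  have h' : ((klCertB1gWinC.gamma : ℚ) : ℝ) / (2 * ((klMresWinC : ℚ) : ℝ)) = 32921 / 203927552 := by
    have := congrArg (fun q : ℚ => (q : ℝ)) h
    push_cast at this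
    exact this
  rw [klU0_eq_div hC (by rw [h']; norm_num) (by rw [h']; norm_num), h']

/-- `klU0 (437/16384) M_res(window) (1/16) = 437/3186368 ≈ 1.37·10⁻⁴`. [folklore] -/
theorem klU0_window_d010_d020_Mres : klU0 (437 / 16384) ((klMresWindowD010D020 : ℚ) : ℝ) (1 / 16) = 437 / 3186368 := by
  obtain ⟨h, -, h1⟩ := klU0rowRes_window_d010_d020
  have hC : (0 : ℝ) < ((klMresWindowD010D020 : ℚ) : ℝ) := by
    have : (0 : ℚ) < klMresWindowD010D020 := by decide +kernel
    exact_mod_cast this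
  have h' : (437 / 16384 : ℝ) / (2 * ((klMresWindowD010D020 : ℚ) : ℝ)) = 437 / 3186368 := by
    have := congrArg (fun q : ℚ => (q : ℝ)) h
    push_cast at this
    exact this
  rw [klU0_eq_div hC (by rw [h']; norm_num) (by rw [h']; norm_num), h']

/-! ### §3 The explicit-`U₀` selection statements with the chains resummed (CONDITIONAL on `hE` — RECORD — and `hM` — CLAIMED) -/

/-- **`klCertB1gWinA`, `U₀ = 30209/63248384 ≈ 4.78·10⁻⁴`** (chains resummed, `U₁ = 1/16`): for `μ ∈ [−0.42749, −0.3775]`,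
`0 < U < 30209/63248384`, `χ ≠ B1g`: `channelInfRes ε₀ μ U B1g < channelInfRes ε₀ μ U χ` — CONDITIONAL on `hE` (RECORD class) AND `hM`
(CLAIMED class). [cite: ScalapinoLohHirsch1986, (3)-(4)] -/
theorem klChannelInfRes_B1g_lt_WinA_Mres (hE : klCertB1gWinA.EnclosuresB1g)
    (hM : KlThirdOrder.ResummedFormBound 0 ((klCertB1gWinA.mub : ℚ) : ℝ) ((klCertB1gWinA.mua : ℚ) : ℝ) ((klMresWinA : ℚ) : ℝ) (1 / 16))
    {μ : ℝ} (hμ : μ ∈ Set.Icc ((klCertB1gWinA.mub : ℚ) : ℝ) ((klCertB1gWinA.mua : ℚ) : ℝ)) {U : ℝ} (hU0 : 0 < U)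
    (hU : U < 30209 / 63248384) {χ : D4Irrep} (hχ : χ ≠ D4Irrep.B1g) :
    channelInfRes (squareDispersion 1 0) μ U D4Irrep.B1g < channelInfRes (squareDispersion 1 0) μ U χ :=
  klChannelInfRes_B1g_lt_WinA hE (by exact_mod_cast (by decide +kernel : (0 : ℚ) ≤ klMresWinA)) hM hμ hU0
    (by rw [klU0_WinA_Mres]; exact hU) hχ

/-- **`klCertB1gWinB`, `U₀ = 437/2124416 ≈ 2.06·10⁻⁴`** (chains resummed, `U₁ = 1/16`): for `μ ∈ [−0.3775, −0.2275]`, `0 < U < 437/2124416`,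
`χ ≠ B1g`: `channelInfRes ε₀ μ U B1g < channelInfRes ε₀ μ U χ` — CONDITIONAL on `hE` (RECORD) AND `hM` (CLAIMED). [cite: ScalapinoLohHirsch1986, (3)-(4)] -/
theorem klChannelInfRes_B1g_lt_WinB_Mres (hE : klCertB1gWinB.EnclosuresB1g)
    (hM : KlThirdOrder.ResummedFormBound 0 ((klCertB1gWinB.mub : ℚ) : ℝ) ((klCertB1gWinB.mua : ℚ) : ℝ) ((klMresWinB : ℚ) : ℝ) (1 / 16))
    {μ : ℝ} (hμ : μ ∈ Set.Icc ((klCertB1gWinB.mub : ℚ) : ℝ) ((klCertB1gWinB.mua : ℚ) : ℝ)) {U : ℝ} (hU0 : 0 < U)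
    (hU : U < 437 / 2124416) {χ : D4Irrep} (hχ : χ ≠ D4Irrep.B1g) :
    channelInfRes (squareDispersion 1 0) μ U D4Irrep.B1g < channelInfRes (squareDispersion 1 0) μ U χ :=
  klChannelInfRes_B1g_lt_WinB hE (by exact_mod_cast (by decide +kernel : (0 : ℚ) ≤ klMresWinB)) hM hμ hU0
    (by rw [klU0_WinB_Mres]; exact hU) hχ

/-- **`klCertB1gWinC`, `U₀ = 32921/203927552 ≈ 1.61·10⁻⁴`** (chains resummed, `U₁ = 1/16`): for `μ ∈ [−0.2275, −0.1775]`,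
`0 < U < 32921/203927552`, `χ ≠ B1g`: `channelInfRes ε₀ μ U B1g < channelInfRes ε₀ μ U χ` — CONDITIONAL on `hE` (RECORD) AND `hM` (CLAIMED).
[cite: ScalapinoLohHirsch1986, (3)-(4)] -/
theorem klChannelInfRes_B1g_lt_WinC_Mres (hE : klCertB1gWinC.EnclosuresB1g)
    (hM : KlThirdOrder.ResummedFormBound 0 ((klCertB1gWinC.mub : ℚ) : ℝ) ((klCertB1gWinC.mua : ℚ) : ℝ) ((klMresWinC : ℚ) : ℝ) (1 / 16))
    {μ : ℝ} (hμ : μ ∈ Set.Icc ((klCertB1gWinC.mub : ℚ) : ℝ) ((klCertB1gWinC.mua : ℚ) : ℝ)) {U : ℝ} (hU0 : 0 < U)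
    (hU : U < 32921 / 203927552) {χ : D4Irrep} (hχ : χ ≠ D4Irrep.B1g) :
    channelInfRes (squareDispersion 1 0) μ U D4Irrep.B1g < channelInfRes (squareDispersion 1 0) μ U χ :=
  klChannelInfRes_B1g_lt_WinC hE (by exact_mod_cast (by decide +kernel : (0 : ℚ) ≤ klMresWinC)) hM hμ hU0
    (by rw [klU0_WinC_Mres]; exact hU) hχ

/-- **The doping window `δ ∈ [0.10, 0.20]`, `U₀ = 437/3186368 ≈ 1.37·10⁻⁴`** (chains resummed, `U₁ = 1/16`): for every `μ ∈ [−0.42749, −0.1775]`,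
every `0 < U < 437/3186368` and every `χ ≠ B1g`, `channelInfRes ε₀ μ U B1g < channelInfRes ε₀ μ U χ` — CONDITIONAL on the three records' `hE`
(RECORD class) AND `hM` (CLAIMED class, `M_res = 99574/1024` on the whole window). [cite: ScalapinoLohHirsch1986, (3)-(4)] -/
theorem klChannelInfRes_B1g_lt_window_d010_d020_Mres (hA : klCertB1gWinA.EnclosuresB1g) (hB : klCertB1gWinB.EnclosuresB1g)
    (hC : klCertB1gWinC.EnclosuresB1g)
    (hM : KlThirdOrder.ResummedFormBound 0 (-0.42749) (-0.1775) ((klMresWindowD010D020 : ℚ) : ℝ) (1 / 16))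
    {μ : ℝ} (hμ : μ ∈ Set.Icc (-0.42749 : ℝ) (-0.1775)) {U : ℝ} (hU0 : 0 < U) (hU : U < 437 / 3186368)
    {χ : D4Irrep} (hχ : χ ≠ D4Irrep.B1g) :
    channelInfRes (squareDispersion 1 0) μ U D4Irrep.B1g < channelInfRes (squareDispersion 1 0) μ U χ :=
  klChannelInfRes_B1g_lt_window_d010_d020 hA hB hC (by exact_mod_cast (by decide +kernel : (0 : ℚ) ≤ klMresWindowD010D020)) hM hμ hU0
    (by rw [klU0_window_d010_d020_Mres]; exact hU) hχ

/-! ### §4 The two window rows as functions of the hole doping `δ ∈ [0.10, 0.20]` -/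

/-- **`U₀(δ)` through third order, `δ ∈ [0.10, 0.20]`**: at the free-band chemical potential `μ(δ) = chemicalPotentialOfDensity ε₀ (1 − δ)`, for
every `0 < U < 437/3182240 ≈ 1.37·10⁻⁴` and every `χ ≠ B1g`, `channelInf3 ε₀ μ(δ) U B1g < channelInf3 ε₀ μ(δ) U χ` — CONDITIONAL on `hE` (RECORD
class) AND `hM` (CLAIMED class, `M₃ = 99445/1024`). [cite: RaghuKivelsonScalapino2010, §III Fig. 2, §IV] -/
theorem klChannelInf3_B1g_lt_doping_d010_d020_M3 (hA : klCertB1gWinA.EnclosuresB1g) (hB : klCertB1gWinB.EnclosuresB1g)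
    (hC : klCertB1gWinC.EnclosuresB1g) (hM : KlThirdOrder.FormBound 0 (-0.42749) (-0.1775) ((klM3WindowD010D020 : ℚ) : ℝ))
    {δ : ℝ} (hδ : δ ∈ Set.Icc (0.10 : ℝ) 0.20) {U : ℝ} (hU0 : 0 < U) (hU : U < 437 / 3182240)
    {χ : D4Irrep} (hχ : χ ≠ D4Irrep.B1g) :
    channelInf3 (squareDispersion 1 0) (chemicalPotentialOfDensity (squareDispersion 1 0) (1 - δ)) U D4Irrep.B1g <
      channelInf3 (squareDispersion 1 0) (chemicalPotentialOfDensity (squareDispersion 1 0) (1 - δ)) U χ :=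
  klChannelInf3_B1g_lt_window_d010_d020_M3 hA hB hC hM (muOfDoping_mem_window_d010_d020 δ hδ) hU0 hU hχ

/-- **`U₀(δ)` with the chains resummed, `δ ∈ [0.10, 0.20]`** (`U₁ = 1/16`): at `μ(δ) = chemicalPotentialOfDensity ε₀ (1 − δ)`, for every
`0 < U < 437/3186368 ≈ 1.37·10⁻⁴` and every `χ ≠ B1g`, `channelInfRes ε₀ μ(δ) U B1g < channelInfRes ε₀ μ(δ) U χ` — CONDITIONAL on `hE` (RECORD
class) AND `hM` (CLAIMED class, `M_res = 99574/1024`). [cite: ScalapinoLohHirsch1986, (3)-(4)] -/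
theorem klChannelInfRes_B1g_lt_doping_d010_d020_Mres (hA : klCertB1gWinA.EnclosuresB1g) (hB : klCertB1gWinB.EnclosuresB1g)
    (hC : klCertB1gWinC.EnclosuresB1g)
    (hM : KlThirdOrder.ResummedFormBound 0 (-0.42749) (-0.1775) ((klMresWindowD010D020 : ℚ) : ℝ) (1 / 16))
    {δ : ℝ} (hδ : δ ∈ Set.Icc (0.10 : ℝ) 0.20) {U : ℝ} (hU0 : 0 < U) (hU : U < 437 / 3186368)
    {χ : D4Irrep} (hχ : χ ≠ D4Irrep.B1g) :
    channelInfRes (squareDispersion 1 0) (chemicalPotentialOfDensity (squareDispersion 1 0) (1 - δ)) U D4Irrep.B1g <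
      channelInfRes (squareDispersion 1 0) (chemicalPotentialOfDensity (squareDispersion 1 0) (1 - δ)) U χ :=
  klChannelInfRes_B1g_lt_window_d010_d020_Mres hA hB hC hM (muOfDoping_mem_window_d010_d020 δ hδ) hU0 hU hχ

end Summit.HubbardSuperconductivity.HubbardSuperconductivity.Theorems

end
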